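import Summits.QuantumFields.YangMills.Theorems.FiniteRankMirrorRungMirrorFunctional
import Summits.QuantumFields.YangMills.Theorems.StaticSourceWitnessRungDipoleEnergyFloor

/-!
# Route `StaticSourceWitness`, crux X₁ `StaticSourceResponse` (stmt-QuantumFields-25284):
# lattice-Maxwell rung in the crux's LITERAL block shape (reflected loop, crux window, scheme-indexed)

Banking file (`--supports stmt-QuantumFields-25284`, tribunal-w seat `ym-mirror-bc5w-1` g6, 2026-08-28),
a complement to `Theorems/StaticSourceWitnessRungDipoleEnergyFloor.lean`.  The head theorem there,
`latticeMaxwell_staticSourceResponse`, is X₁-SHAPED: it places the source rectangle directly in negative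
time (`x₀ + R + T ≤ −1`, `−ℓ ≤ a x₀`) and reads the probe over the sibling cube `cube L`.  The crux
`StaticSourceResponse` instead quantifies a rectangle `rectWalk x i j R T` in POSITIVE time
(`R + T ≤ x 0`, `(x 0 + R + T + 1)·a β ≤ ℓ`, `x 0 + R + T + 2 ≤ L`), composes its Wilson loop with the
time reflection `cfgReflect`, reads the probe over `box 4 L` of `Literature.Probability.LatticeModels`, and
indexes everything by a scheme `β ↦ a β` with `0 < a β → 0`.  This file proves the X₁ block of the abelian
lattice gauge theory `μM = curvatureGaussianField 4 1` in exactly that shape, symbol for symbol under the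
four-entry dictionary

  `torusE G r β L F ↦ ∫ F dμM`,  `dens G r y ↦ densA y`,  `cfgReflect ↦ cfgReflA`
  (the banked reflection of `Theorems/FiniteRankMirrorRungMirrorFunctional.lean`),
  `wilsonLoopObs (Re tr ρ) (rectWalk x i j R T) ↦ wLoop rect`, `rect` = the plaquette sheet of the crux's
  rectangle data `(x, i, j, R, T)` (written inline as a `let`; lattice Stokes: the abelian loop of the boundary
  walk is `cos` of the plaquette-angle sum over the sheet).

* §1 `sheet_one_two` — in the directions `(1, 2)` the sheet is the `(1,2)`-plane rectangle `rectPlaq x P12 R T`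
  of the sibling files (no new definition is introduced).
* §2 `variance_holonomy`, `integral_wLoop_rectPlaq_P12` — `Var Φ_rect = ∑_{p,p'} (dGd*)(p,p')`, and by the
  translation invariance of the parallel `(1,2)` kernel (`curvatureTwoPoint_P12`) the loop expectation
  `E[w] = e^{−Var Φ/2}` of a `(1,2)` rectangle does not depend on its base point.
* §3 `wLoop_rectPlaq_cy_cfgReflA` — the reflection carries the loop based at `+X e₀` to the loop based at
  `−X e₀`: `w_{rect(X e₀)} ∘ Θ = w_{rect(−X e₀)}` (spacelike plaquettes: sign `+1`, site `ϑy`).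
* §4 `dipoleEnergyFloor_config` — the hyperscaling configuration of file 5/5 with its scales made explicit
  (`N = ⌊ℓ/(64a)⌋ ≥ 1`, `X = ⌊ℓ/(2a)⌋ ≥ 2N`, `(X + 2N + 1)a ≤ ℓ`, `X + 2N + 2 ≤ L`) and the same floor
  `dipoleEnergy ≥ 1/(16π⁴16650⁴)` (proof re-run from `dipoleEnergyFloor`, whose packaged window does not
  record these inequalities).
* §5 `latticeMaxwell_staticSourceResponse_literal` (spacing-indexed, `∀ 0 < a ≤ a₀`),
  `latticeMaxwell_staticSourceResponse_scheme` (for EVERY positive scheme `a β → 0`, the crux's third conjunct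
  verbatim under the dictionary) and `latticeMaxwell_staticSourceResponse_shell` (the crux body
  `∃ a, (∀ β, 0 < a β) ∧ Tendsto a atTop (nhds 0) ∧ …` with the representation binder dropped): the witness is
  `x = X e₀`, `(i, j) = (1, 2)`, `R = T = N`, `v = wfun ℓ`, `c₁ = 1/(16π⁴16650⁴)`, `Λ₅ = ℓ`.

This is a BC5 / T3 witness of weakness for X₁ only (C's analogue TRUE in a decided model where S's
clause (ii) analogue is FALSE: `FiniteRankMirror.Rung.not_ntFreeAbelian`).  NOTHING here proves the
Yang–Mills mass gap, `BalabanLadder.NT`, or `StaticSourceResponse` itself (compact SIMPLE `G`, Wilson's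
measure); no item of the route is closed by this file.
-/

set_option autoImplicit false

open MeasureTheory ProbabilityTheory Filter
open scoped Real NNReal ENNReal Topology

noncomputable section

namespace Summit.QuantumFields.YangMills.Theorems.StaticSourceWitness.Rung

section Literal

open Literature.Probability.LatticeModels Literature.MathematicalPhysics.QuantumLattice
  Literature.MathematicalPhysics.QuantumFieldTheory
open Summit.QuantumFields.YangMills.Theorems.FiniteRankMirror.Rung
  (tref tref_apply_zero tref_apply_of_ne reflPlaq reflSign cfgReflA reflPlaq_P12)
open Metric Set

/-! ## §1 The crux's rectangle data as a plaquette sheet -/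

/-- The crux's rectangle data `(x, i, j, R, T)` name the plaquette sheet
`if h : i < j then rectPlaq x ⟨(i, j), h⟩ R T else if h' : j < i then rectPlaq x ⟨(j, i), h'⟩ T R else ∅`
(the plaquettes whose angle sum is the abelian holonomy of `rectWalk x i j R T`, lattice Stokes; `∅` in the
degenerate case `i = j`); in the directions `(1, 2)` it is the `(1,2)`-plane rectangle of the sibling files.
[folklore] -/
theorem sheet_one_two (x : Site 4) (R T : ℕ) :
    (if h : (1 : Fin 4) < 2 then rectPlaq x ⟨((1 : Fin 4), (2 : Fin 4)), h⟩ R T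
      else if h' : (2 : Fin 4) < 1 then rectPlaq x ⟨((2 : Fin 4), (1 : Fin 4)), h'⟩ T R else ∅) =
      rectPlaq x P12 R T := by
  rw [dif_pos (by decide : (1 : Fin 4) < 2)]
  rfl

/-! ## §2 The loop expectation of a `(1,2)` rectangle does not depend on its base point -/

/-- The `(1,2)` rectangle at `x` as the image of the `R × T` grid. [folklore] -/
theorem rectPlaq_P12_eq (x : Site 4) (R T : ℕ) : rectPlaq x P12 R T =
    (Finset.range R ×ˢ Finset.range T).image
      fun mn => ((x + (mn.1 : ℤ) • Pi.single 1 1 + (mn.2 : ℤ) • Pi.single 2 1 : Site 4), P12) := rfl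

/-- Grid coordinates of a `(1,2)` rectangle are injective. [folklore] -/
theorem grid12_inj (x : Site 4) {mn mn' : ℕ × ℕ}
    (h : (((x + (mn.1 : ℤ) • Pi.single 1 1 + (mn.2 : ℤ) • Pi.single 2 1 : Site 4), P12) : ZdPlaquette 4) =
      ((x + (mn'.1 : ℤ) • Pi.single 1 1 + (mn'.2 : ℤ) • Pi.single 2 1 : Site 4), P12)) : mn = mn' := by
  have h1 := congr_arg (fun q : ZdPlaquette 4 => q.1 1) h
  have h2 := congr_arg (fun q : ZdPlaquette 4 => q.1 2) h
  simp at h1 h2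
  exact Prod.ext h1 h2

/-- A sum over a `(1,2)` rectangle as a sum over its grid. [folklore] -/
theorem sum_rectPlaq_P12 (x : Site 4) (R T : ℕ) (f : ZdPlaquette 4 → ℝ) :
    ∑ p ∈ rectPlaq x P12 R T, f p = ∑ mn ∈ Finset.range R ×ˢ Finset.range T,
      f ((x + (mn.1 : ℤ) • Pi.single 1 1 + (mn.2 : ℤ) • Pi.single 2 1 : Site 4), P12) := by
  rw [rectPlaq_P12_eq, Finset.sum_image]
  intro mn _ mn' _ h
  exact grid12_inj x h

/-- Translation invariance of the parallel `(1,2)`-plaquette kernel. [folklore] -/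
theorem curvatureTwoPoint_P12_translate (x y t : Site 4) :
    curvatureTwoPoint (x + t, P12) (y + t, P12) = curvatureTwoPoint (x, P12) (y, P12) := by
  rw [curvatureTwoPoint_P12, curvatureTwoPoint_P12, add_sub_add_right_eq_sub]

/-- `Var Φ_rect = ∑_{p, p' ∈ rect} (dGd*)(p, p')`. [folklore] -/
theorem variance_holonomy (rect : Finset (ZdPlaquette 4)) :
    Var[holonomy rect; μM] = ∑ p ∈ rect, ∑ p' ∈ rect, curvatureTwoPoint p p' := by
  haveI := isProbabilityMeasure_μM
  show Var[fun ω => ∑ p ∈ rect, ω p 0; μM] = _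
  rw [variance_fun_sum' (fun p _ => memLp_eval p)]
  refine Finset.sum_congr rfl fun p _ => Finset.sum_congr rfl fun p' _ => ?_
  rw [covariance_eval_curvatureGaussianField (by norm_num : 3 ≤ 4) 1 p p' 0 0, if_pos rfl]

/-- The holonomy variance of a `(1,2)` rectangle does not depend on its base point. [folklore] -/
theorem variance_holonomy_rectPlaq_P12 (x x' : Site 4) (R T : ℕ) :
    Var[holonomy (rectPlaq x P12 R T); μM] = Var[holonomy (rectPlaq x' P12 R T); μM] := by
  rw [variance_holonomy, variance_holonomy, sum_rectPlaq_P12, sum_rectPlaq_P12]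
  refine Finset.sum_congr rfl fun mn _ => ?_
  rw [sum_rectPlaq_P12, sum_rectPlaq_P12]
  refine Finset.sum_congr rfl fun mn' _ => ?_
  have e : (x + (mn.1 : ℤ) • (Pi.single 1 1 : Site 4) + (mn.2 : ℤ) • Pi.single 2 1) -
      (x + (mn'.1 : ℤ) • Pi.single 1 1 + (mn'.2 : ℤ) • Pi.single 2 1) =
      (x' + (mn.1 : ℤ) • (Pi.single 1 1 : Site 4) + (mn.2 : ℤ) • Pi.single 2 1) -
      (x' + (mn'.1 : ℤ) • Pi.single 1 1 + (mn'.2 : ℤ) • Pi.single 2 1) := by abel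
  rw [curvatureTwoPoint_P12, curvatureTwoPoint_P12, e]

/-- **`E_μ[w]` of a `(1,2)` rectangle does not depend on its base point** (`E[w] = e^{−Var Φ/2}`,
`latticeMaxwell_wLoop_eq`). [folklore] -/
theorem integral_wLoop_rectPlaq_P12 (x x' : Site 4) (R T : ℕ) :
    ∫ ω, wLoop (rectPlaq x P12 R T) ω ∂μM = ∫ ω, wLoop (rectPlaq x' P12 R T) ω ∂μM := by
  rw [latticeMaxwell_wLoop_eq, latticeMaxwell_wLoop_eq, variance_holonomy_rectPlaq_P12 x x' R T]

/-! ## §3 The time reflection carries the loop at `+X e₀` to the loop at `−X e₀` -/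

/-- `ϑ (X e₀ + m e₁ + n e₂) = −X e₀ + m e₁ + n e₂ = px X m n`. [folklore] -/
theorem tref_cy_grid (X m n : ℕ) :
    tref (cy X + (m : ℤ) • Pi.single 1 1 + (n : ℤ) • Pi.single 2 1) = px X m n := by
  funext k
  by_cases hk : k = 0
  · subst hk
    rw [tref_apply_zero, px_apply_0]
    simp [cy]
  · rw [tref_apply_of_ne _ hk]
    simp [px, xr, cy, hk]

/-- Spacelike plaquettes are reflected with sign `+1`. [folklore] -/
theorem reflSign_P12 (y : Site 4) : reflSign (y, P12) = 1 := by
  simp [reflSign, P12]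

/-- `Φ_{rect(X e₀)} ∘ Θ = Φ_{rect(−X e₀)}`. [folklore] -/
theorem holonomy_rectPlaq_cy_cfgReflA (X R T : ℕ) (ω : Cfg) :
    holonomy (rectPlaq (cy X) P12 R T) (cfgReflA ω) = holonomy (rectPlaq (xr X) P12 R T) ω := by
  rw [holonomy, holonomy, sum_rectPlaq_P12, sum_rectPlaq_P12]
  refine Finset.sum_congr rfl fun mn _ => ?_
  simp only [cfgReflA]
  rw [reflSign_P12, one_mul, reflPlaq_P12, tref_cy_grid]
  rfl

/-- **`w_{rect(X e₀)} ∘ Θ = w_{rect(−X e₀)}`**: the crux's reflected positive-time loop IS the sibling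
files' negative-time mirror loop. [folklore] -/
theorem wLoop_rectPlaq_cy_cfgReflA (X R T : ℕ) (ω : Cfg) :
    wLoop (rectPlaq (cy X) P12 R T) (cfgReflA ω) = wLoop (rectPlaq (xr X) P12 R T) ω := by
  rw [wLoop, wLoop, holonomy_rectPlaq_cy_cfgReflA]

/-! ## §4 The hyperscaling configuration with explicit scales -/

/-- **The dipole-energy floor with its configuration exposed**: `R₀ ≥ 1` (kernel cone radius) such that for
every window `ℓ > 0`, spacing `0 < a ≤ ℓ/(128R₀)` and volume `L` with `ℓ ≤ aL` there are lattice scales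
`N ≥ 1`, `X ≥ 2N` with `(X + 2N + 1)a ≤ ℓ`, `X + 2N + 2 ≤ L` and
`dipoleEnergy a (wfun ℓ) (rectPlaq (−X e₀) P12 N N) L ≥ 1/(16π⁴16650⁴)` (the proof of `dipoleEnergyFloor`,
re-run to record the scales). -/
theorem dipoleEnergyFloor_config : ∃ R₀ : ℝ, 1 ≤ R₀ ∧ ∀ (ℓ : ℝ) (hℓ : 0 < ℓ) (a : ℝ), 0 < a →
    a ≤ ℓ / (128 * R₀) → ∀ L : ℕ, ℓ ≤ a * L →
      ∃ X N : ℕ, 1 ≤ N ∧ N + N ≤ X ∧ ((X : ℝ) + N + N + 1) * a ≤ ℓ ∧ X + N + N + 2 ≤ L ∧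
        1 / (16 * π ^ 4 * 16650 ^ 4) ≤
          dipoleEnergy a (wfun ℓ hℓ : EuclideanSpace ℝ (Fin 4) → ℝ) (rectPlaq (xr X) P12 N N) L := by
  obtain ⟨R₀, hR₀1, hker⟩ := kernel_cone_lower
  have hR₀0 : 0 ≤ R₀ := by linarith
  refine ⟨R₀, hR₀1, fun ℓ hℓ a ha ha₀ L hL => ?_⟩
  -- the two lattice scales `N = ⌊ℓ/(64a)⌋`, `X = ⌊ℓ/(2a)⌋`
  set t : ℝ := ℓ / (64 * a) with ht
  have hat : a * t = ℓ / 64 := by rw [ht]; field_simp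
  have ht2 : 2 * R₀ ≤ t := by
    rw [ht, le_div_iff₀ (by positivity)]
    have : a * (128 * R₀) ≤ ℓ := by rwa [le_div_iff₀ (by positivity)] at ha₀
    linarith
  set N : ℕ := ⌊t⌋₊ with hN
  have htN : (N : ℝ) ≤ t := Nat.floor_le (by positivity)
  have htN' : t < N + 1 := Nat.lt_floor_add_one t
  have hN1 : (1 : ℝ) ≤ N := by linarith
  have hRN : R₀ ≤ N := by linarith
  have hNnat : 1 ≤ N := by exact_mod_cast hN1
  set X : ℕ := ⌊ℓ / (2 * a)⌋₊ with hX
  have hX32t : ℓ / (2 * a) = 32 * t := by rw [ht]; field_simp; ring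
  have hXle : (X : ℝ) ≤ 32 * t := by rw [← hX32t]; exact Nat.floor_le (by positivity)
  have hXgt : 32 * t < X + 1 := by rw [← hX32t]; exact Nat.lt_floor_add_one _
  have hX1nat : 32 * N ≤ X := by
    have h : ((32 * N : ℕ) : ℝ) < X + 1 := by push_cast; linarith
    have h' : 32 * N < X + 1 := by exact_mod_cast h
    omega
  have hX1 : 32 * (N : ℝ) ≤ X := by exact_mod_cast hX1nat
  have hX2 : (X : ℝ) ≤ 64 * N := by linarith
  have haN : a * N ≤ ℓ / 64 := by rw [← hat]; exact mul_le_mul_of_nonneg_left htN ha.le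
  have ha32t : a * (32 * t) = ℓ / 2 := by
    rw [show a * (32 * t) = 32 * (a * t) by ring, hat]; ring
  have haX : a * X ≤ ℓ / 2 := by
    have : a * X ≤ a * (32 * t) := mul_le_mul_of_nonneg_left hXle ha.le
    linarith
  have haX' : ℓ / 2 - a < a * X := by
    have : a * (32 * t) < a * (X + 1) := mul_lt_mul_of_pos_left hXgt ha
    linarith
  have ha128 : a ≤ ℓ / 128 := by
    have : a * (128 * R₀) ≤ ℓ := by rwa [le_div_iff₀ (by positivity)] at ha₀
    rw [le_div_iff₀ (by norm_num)]
    nlinarith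
  have habsX : |a * X - ℓ / 2| ≤ ℓ / 128 := by
    rw [abs_le]; constructor <;> linarith
  have hLa : ℓ / a ≤ L := by rw [div_le_iff₀ ha]; linarith
  have hLt : ℓ / a = 64 * t := by rw [ht]; field_simp
  have ht1 : 1 ≤ t := by linarith
  refine ⟨X, N, hNnat, by omega, ?_, ?_, ?_⟩
  · -- the window: `(X + 2N + 1)·a ≤ ℓ/2 + ℓ/32 + ℓ/128 ≤ ℓ`
    have e : ((X : ℝ) + N + N + 1) * a = a * X + a * N + a * N + a := by ring
    rw [e]
    linarith
  · -- the volume: `X + 2N + 2 ≤ 35 t ≤ 64 t = ℓ/a ≤ L`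
    have h1 : ((X : ℝ) + N + N + 2) ≤ L := by
      have : (X : ℝ) + N + N + 2 ≤ 36 * t := by linarith
      have : 36 * t ≤ 64 * t := by linarith
      linarith
    exact_mod_cast h1
  · -- the floor (verbatim the computation of `dipoleEnergyFloor`)
    have hsub : box X N ⊆ cube L := by
      apply box_subset_cube
      have h1 : ((X : ℝ) + N) ≤ L := by
        have : (X : ℝ) + N ≤ 33 * t := by linarith
        have : 33 * t ≤ 64 * t := by nlinarith
        linarith
      exact_mod_cast h1
    set kmin : ℝ := 1 / (4 * π ^ 2 * (16650 * (N : ℝ) ^ 2) ^ 2) with hkmin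
    have hkmin0 : 0 ≤ (N : ℝ) ^ 2 * kmin := by positivity
    have hterm : ∀ y ∈ box X N, ((N : ℝ) ^ 2 * kmin) ^ 2 ≤
        wfun ℓ hℓ (a • siteToE y) * ∑ q ∈ plaqAt y, dipoleField (rectPlaq (xr X) P12 N N) q ^ 2 := by
      intro y hy
      rw [probe_one hℓ ha.le hy habsX haN, one_mul]
      refine le_trans ?_ (Finset.single_le_sum (fun q _ => sq_nonneg _) (mem_plaqAt y))
      exact pow_le_pow_left₀ hkmin0 (dipoleField_lower hker hR₀0 hN1 hRN hX1 hX2 hy) 2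
    have hN0 : (0 : ℝ) < N := by linarith
    calc 1 / (16 * π ^ 4 * 16650 ^ 4) = (N : ℝ) ^ 4 * ((N : ℝ) ^ 2 * kmin) ^ 2 := by
          rw [hkmin]; field_simp; ring
      _ ≤ ((box X N).card : ℝ) * ((N : ℝ) ^ 2 * kmin) ^ 2 := by
          rw [card_box]; push_cast
          apply mul_le_mul_of_nonneg_right _ (sq_nonneg _)
          have : (N : ℝ) ≤ 2 * N + 1 := by linarith
          exact pow_le_pow_left₀ hN0.le this 4
      _ = (box X N).card • ((N : ℝ) ^ 2 * kmin) ^ 2 := by rw [nsmul_eq_mul]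
      _ ≤ ∑ y ∈ box X N, wfun ℓ hℓ (a • siteToE y) *
            ∑ q ∈ plaqAt y, dipoleField (rectPlaq (xr X) P12 N N) q ^ 2 :=
          Finset.card_nsmul_le_sum _ _ _ hterm
      _ ≤ dipoleEnergy a (wfun ℓ hℓ) (rectPlaq (xr X) P12 N N) L := by
          apply Finset.sum_le_sum_of_subset_of_nonneg hsub
          intro y _ _
          exact mul_nonneg (wfun_nonneg hℓ _) (Finset.sum_nonneg fun _ _ => sq_nonneg _)

/-! ## §5 X₁'s block in the crux's literal shape -/

/-- **The lattice-Maxwell rung of X₁ in the crux's literal block shape (spacing-indexed)**: for every window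
`ℓ > 0` a probe `v` (`supp v ⊆ {y₀ > 0} ∩ B̄(0, ℓ)`, `v ≠ 0`) and `c₁, a₀ > 0` such that for all spacings
`0 < a ≤ a₀` and all volumes `L` with `ℓ ≤ aL` there are `x : ℤ⁴`, directions `i ≠ j` and `R, T ≥ 1` with
the crux's window constraints `R + T ≤ x₀`, `(x₀ + R + T + 1)·a ≤ ℓ`, `x₀ + R + T + 2 ≤ L` (a rectangle in
POSITIVE time) whose REFLECTED loop responds to the probe read over `box 4 L`:
`0 < E[w] ∧ c₁·E[w] ≤ |E[(w∘Θ)·Ṽ_v] − E[w]·E[Ṽ_v]|`.  (Witness: `x = X e₀`, `(i,j) = (1,2)`, `R = T = N`.) -/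
theorem latticeMaxwell_staticSourceResponse_literal :
    ∀ ℓ : ℝ, 0 < ℓ → ∃ (v : SchwartzMap (EuclideanSpace ℝ (Fin 4)) ℝ) (c₁ a₀ : ℝ),
      tsupport (v : EuclideanSpace ℝ (Fin 4) → ℝ) ⊆ {y | 0 < y 0} ∧
      tsupport (v : EuclideanSpace ℝ (Fin 4) → ℝ) ⊆ Metric.closedBall 0 ℓ ∧
      (v : EuclideanSpace ℝ (Fin 4) → ℝ) ≠ 0 ∧ 0 < c₁ ∧ 0 < a₀ ∧
      ∀ a : ℝ, 0 < a → a ≤ a₀ → ∀ L : ℕ, ℓ ≤ a * L →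
        ∃ (x : Fin 4 → ℤ) (i j : Fin 4) (R T : ℕ),
          let rect : Finset (ZdPlaquette 4) :=
            if h : i < j then rectPlaq x ⟨(i, j), h⟩ R T else if h' : j < i then rectPlaq x ⟨(j, i), h'⟩ T R else ∅;
          i ≠ j ∧ 1 ≤ R ∧ 1 ≤ T ∧ ((R : ℤ) + T ≤ x 0) ∧
          ((x 0 : ℝ) + R + T + 1) * a ≤ ℓ ∧ (x 0 + R + T + 2 ≤ (L : ℤ)) ∧
          0 < ∫ ω, wLoop rect ω ∂μM ∧
          c₁ * ∫ ω, wLoop rect ω ∂μM ≤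
            |(∫ ω, wLoop rect (cfgReflA ω) *
                  ∑ y ∈ Literature.Probability.LatticeModels.box 4 L,
                    v (a • siteToE y) * densA y ω ∂μM)
              - (∫ ω, wLoop rect ω ∂μM) *
                  (∫ ω, ∑ y ∈ Literature.Probability.LatticeModels.box 4 L,
                    v (a • siteToE y) * densA y ω ∂μM)| := by
  intro ℓ hℓ
  obtain ⟨R₀, hR₀1, hcfg⟩ := dipoleEnergyFloor_config
  refine ⟨wfun ℓ hℓ, 1 / (16 * π ^ 4 * 16650 ^ 4), ℓ / (128 * R₀), wfun_tsupport_pos hℓ,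
    wfun_tsupport_ball hℓ, wfun_ne_zero hℓ, by positivity, by positivity, ?_⟩
  intro a ha ha₀ L hL
  obtain ⟨X, N, hN1, h2N, hwin, hvol, hfloor⟩ := hcfg ℓ hℓ a ha ha₀ L hL
  refine ⟨cy X, 1, 2, N, N, ?_⟩
  dsimp only
  rw [sheet_one_two]
  refine ⟨by decide, hN1, hN1, ?_, ?_, ?_, ?_⟩
  · rw [cy_apply_0]; exact_mod_cast h2N
  · rw [cy_apply_0]; push_cast; exact hwin
  · rw [cy_apply_0]; exact_mod_cast hvol
  · simp_rw [wLoop_rectPlaq_cy_cfgReflA]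
    rw [integral_wLoop_rectPlaq_P12 (cy X) (xr X)]
    exact latticeMaxwell_X1_of_floor hfloor

/-- **The lattice-Maxwell rung of X₁, literal scheme-indexed shape**: for EVERY positive scheme `a β → 0`
(the crux's `(∀ β, 0 < a β) ∧ Tendsto a atTop (nhds 0)`), the third conjunct of `StaticSourceResponse`
verbatim under the dictionary `torusE G r β L F ↦ ∫ F dμM`, `dens G r ↦ densA`, `cfgReflect ↦ cfgReflA`,
`wilsonLoopObs (Re tr ρ) (rectWalk x i j R T) ↦ wLoop rect` (`rect` the plaquette sheet of `(x, i, j, R, T)`).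
[this route] -/
theorem latticeMaxwell_staticSourceResponse_scheme (a : ℝ → ℝ) (ha : ∀ β, 0 < a β)
    (ha0 : Tendsto a atTop (nhds 0)) :
    ∀ ℓ : ℝ, 0 < ℓ → ∃ (v : SchwartzMap (EuclideanSpace ℝ (Fin 4)) ℝ) (c₁ β₅ Λ₅ : ℝ),
      tsupport (v : EuclideanSpace ℝ (Fin 4) → ℝ) ⊆ {y | 0 < y 0} ∧
      tsupport (v : EuclideanSpace ℝ (Fin 4) → ℝ) ⊆ Metric.closedBall 0 ℓ ∧
      (v : EuclideanSpace ℝ (Fin 4) → ℝ) ≠ 0 ∧ 0 < c₁ ∧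
      ∀ β : ℝ, β₅ ≤ β → ∀ L : ℕ, Λ₅ ≤ a β * L →
        ∃ (x : Fin 4 → ℤ) (i j : Fin 4) (R T : ℕ),
          let rect : Finset (ZdPlaquette 4) :=
            if h : i < j then rectPlaq x ⟨(i, j), h⟩ R T else if h' : j < i then rectPlaq x ⟨(j, i), h'⟩ T R else ∅;
          i ≠ j ∧ 1 ≤ R ∧ 1 ≤ T ∧ ((R : ℤ) + T ≤ x 0) ∧
          ((x 0 : ℝ) + R + T + 1) * a β ≤ ℓ ∧ (x 0 + R + T + 2 ≤ (L : ℤ)) ∧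
          0 < ∫ ω, wLoop rect ω ∂μM ∧
          c₁ * ∫ ω, wLoop rect ω ∂μM ≤
            |(∫ ω, wLoop rect (cfgReflA ω) *
                  ∑ y ∈ Literature.Probability.LatticeModels.box 4 L,
                    v (a β • siteToE y) * densA y ω ∂μM)
              - (∫ ω, wLoop rect ω ∂μM) *
                  (∫ ω, ∑ y ∈ Literature.Probability.LatticeModels.box 4 L,
                    v (a β • siteToE y) * densA y ω ∂μM)| := by
  intro ℓ hℓ
  obtain ⟨v, c₁, a₀, h1, h2, h3, hc₁, ha₀, H⟩ := latticeMaxwell_staticSourceResponse_literal ℓ hℓ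
  obtain ⟨β₅, hβ₅⟩ := Filter.eventually_atTop.1 (ha0.eventually (eventually_lt_nhds ha₀))
  exact ⟨v, c₁, β₅, ℓ, h1, h2, h3, hc₁, fun β hβ L hL => H (a β) (ha β) (hβ₅ β hβ).le L hL⟩

/-- **The crux body in the model** — `∃ a, (∀ β, 0 < a β) ∧ Tendsto a atTop (nhds 0) ∧ (third conjunct)`,
i.e. `StaticSourceResponse` with `∀ G …, ∃ (r : LatticeRep G)` dropped (there is no representation to choose
in the abelian Gaussian model), instantiated with the scheme `a β = e^{−β}`. [this route] -/
theorem latticeMaxwell_staticSourceResponse_shell :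
    ∃ a : ℝ → ℝ, (∀ β, 0 < a β) ∧ Tendsto a atTop (nhds 0) ∧
    ∀ ℓ : ℝ, 0 < ℓ → ∃ (v : SchwartzMap (EuclideanSpace ℝ (Fin 4)) ℝ) (c₁ β₅ Λ₅ : ℝ),
      tsupport (v : EuclideanSpace ℝ (Fin 4) → ℝ) ⊆ {y | 0 < y 0} ∧
      tsupport (v : EuclideanSpace ℝ (Fin 4) → ℝ) ⊆ Metric.closedBall 0 ℓ ∧
      (v : EuclideanSpace ℝ (Fin 4) → ℝ) ≠ 0 ∧ 0 < c₁ ∧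
      ∀ β : ℝ, β₅ ≤ β → ∀ L : ℕ, Λ₅ ≤ a β * L →
        ∃ (x : Fin 4 → ℤ) (i j : Fin 4) (R T : ℕ),
          let rect : Finset (ZdPlaquette 4) :=
            if h : i < j then rectPlaq x ⟨(i, j), h⟩ R T else if h' : j < i then rectPlaq x ⟨(j, i), h'⟩ T R else ∅;
          i ≠ j ∧ 1 ≤ R ∧ 1 ≤ T ∧ ((R : ℤ) + T ≤ x 0) ∧
          ((x 0 : ℝ) + R + T + 1) * a β ≤ ℓ ∧ (x 0 + R + T + 2 ≤ (L : ℤ)) ∧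
          0 < ∫ ω, wLoop rect ω ∂μM ∧
          c₁ * ∫ ω, wLoop rect ω ∂μM ≤
            |(∫ ω, wLoop rect (cfgReflA ω) *
                  ∑ y ∈ Literature.Probability.LatticeModels.box 4 L,
                    v (a β • siteToE y) * densA y ω ∂μM)
              - (∫ ω, wLoop rect ω ∂μM) *
                  (∫ ω, ∑ y ∈ Literature.Probability.LatticeModels.box 4 L,
                    v (a β • siteToE y) * densA y ω ∂μM)| :=
  ⟨fun β => Real.exp (-β), fun _ => Real.exp_pos _, Real.tendsto_exp_neg_atTop_nhds_zero,
    latticeMaxwell_staticSourceResponse_scheme _ (fun _ => Real.exp_pos _)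
      Real.tendsto_exp_neg_atTop_nhds_zero⟩

end Literal

end Summit.QuantumFields.YangMills.Theorems.StaticSourceWitness.Rung

end
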